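import Summits.QuantumFields.QCD.Theses.PauliWegnerSea
import Summits.QuantumFields.QCD.Theorems.MobilityGap.Negative.LowerPin
import Summits.QuantumFields.QCD.Theorems.RobustYangMillsHandover.Negative.ChiralityObstruction

/-!
# `ChiralOneScaleTrajectory` (crux stmt-QuantumFields-17512) — negative-side support: everything in the body
# EXCEPT the pin `reg.IsChiralAtZero` is invariant under up-shifts of the critical mass

Definition-free extract of the standing disprover's `Cruxes/ChiralOneScaleTrajectory/Disproof.lean` §4
(cdisprove cycle 1), in the vocabulary of `Theorems/MobilityGap/Negative/LowerPin.lean` (`fm`, `bare`, `ClauseI`,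
`Lower`, `Sign`; the one-scale clause written out through `fm`).  Write `reg'` for `reg` with
`m_crit(k) ↦ m_crit(k) + a_k M₀ / Z_m(k)`.  Then

* `oneScale_mcrit_shift_iff`, `package_mcrit_shift_iff` — the per-mass package of the crux
  ((i) ∧ one-scale ∧ (iii) ∧ (iv)) for `reg'` at masses `m` IS the package of `reg` at masses `M₀ + m`
  (the masses enter only through the bare trajectory);
* `bodyMinusPin_mcrit_shift` — hence mass scaling, asymptotic scaling and the package at every positive tuple pass
  from `reg` to every up-shift `reg'`, `M₀ ≥ 0`: NOTHING in the body but the pin distinguishes a regularisation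
  from its up-shifted copies (whose realised quark masses are all `≥ M₀`);
* `body_mcrit_shift_iff_chiralAbove` — so the up-shift of a witness is again a witness iff the ORIGINAL
  regularisation is chiral above `M₀` (gapless-at-rate-`ε` tuples with all components `> M₀`, for every `ε`; cf.
  the landed `RobustYangMillsHandover.Negative.isChiralAtZero_mcrit_shift_iff`);
* `packageForcesChirality_iff` / `not_packageForcesChirality_of` — the route text's warning certified for THIS
  package: "package ⇒ chiral" as a `∀ reg` item is EQUIVALENT to "every package-carrying regularisation is chiral
  above EVERY offset `M₀ ≥ 0`", refuted by any single package-carrying regularisation uniformly gapped above some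
  threshold; so the pin must ride inside the `∃ reg`, as filed, and the planner's foreseen split
  `MobilityEdgeIsChiralPoint` must quantify over package-MINIMAL regularisations;
* `packageMinimal_iff`, `not_packageMinimal_of_forall` — minimality ("every down-shift loses the package at some
  positive tuple") unfolded on `reg` itself: for every `M₀ > 0` the package of `reg` fails at some tuple with all
  components `> −M₀`; it fails for every regularisation whose package holds at ALL real tuples (a down-shift orbit
  need not contain a minimal element — `MinimalOneScaleTrajectory` is not a formal consequence of the crux).
-/

noncomputable section

namespace Summit.QuantumFields.QCD.Theorems.ChiralOneScaleTrajectory.Negative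

open scoped BigOperators Topology
open MeasureTheory Filter Set
open Literature.MathematicalPhysics.QuantumFieldTheory Literature.MathematicalPhysics.QuantumLattice
  Literature.Probability.LatticeModels
open Summit.QuantumFields.QCD.Theorems.MobilityGapNegative

variable {Nf : ℕ}

/-- The bare tuple of the shifted regularisation at `m` is the bare tuple of `reg` at `M₀ + m`. -/
theorem bare_mcrit_shift (reg : QCDRegularisation Nf) (M₀ : ℝ) (m : Fin Nf → ℝ) (k : ℕ)
    (reg' : QCDRegularisation Nf)
    (hreg' : reg' = { reg with mcrit := fun k => reg.mcrit k + reg.a k * M₀ / reg.Zm k }) :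
    bare reg' m k = bare reg (fun f => M₀ + m f) k := by
  subst hreg'
  funext fl
  show reg.mcrit k + reg.a k * M₀ / reg.Zm k + reg.a k * m fl / reg.Zm k = reg.mcrit k + reg.a k * (M₀ + m fl) / reg.Zm k
  ring

/-- Shifting and running at `m` is running `reg` at `M₀ + m` (schemes coincide). -/
theorem scheme_mcrit_shift (reg : QCDRegularisation Nf) (M₀ : ℝ) (m : Fin Nf → ℝ) (z shift : QCDField Nf → ℕ → ℝ)
    (reg' : QCDRegularisation Nf)
    (hreg' : reg' = { reg with mcrit := fun k => reg.mcrit k + reg.a k * M₀ / reg.Zm k }) :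
    reg'.scheme m z shift = reg.scheme (fun f => M₀ + m f) z shift := by
  subst hreg'
  simp only [QCDRegularisation.scheme, QCDScheme.mk.injEq, true_and, and_true]
  funext f k
  ring

/-- **The ONE-SCALE clause transports along the shift** (it reads `m` only through the bare tuple). -/
theorem oneScale_mcrit_shift_iff (reg : QCDRegularisation Nf) (M₀ : ℝ) (m : Fin Nf → ℝ)
    (reg' : QCDRegularisation Nf)
    (hreg' : reg' = { reg with mcrit := fun k => reg.mcrit k + reg.a k * M₀ / reg.Zm k }) :
    (∀ q : ℕ, ∃ K₀ s : ℝ, 0 < s ∧ s < 1 ∧ ∀ᶠ k in atTop, ∃ ℓ₀ : ℕ, 1 ≤ ℓ₀ ∧ ℓ₀ ≤ reg'.L k ∧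
      (ℓ₀ : ℝ) * reg'.a k ≤ K₀ * (1 + |Real.log (reg'.a k)|) ∧ ∀ S : ℕ, reg'.L k ≤ S →
        ∀ (f : Fin Nf) (v : Site 4), v ∈ box 4 S → ‖v‖ = (ℓ₀ : ℝ) →
          (ℓ₀ : ℝ) ^ q * (1 + |reg'.β k|) ^ q * fm Nf (reg'.β k) (bare reg' m k) S f v s ≤ 1) ↔
    (∀ q : ℕ, ∃ K₀ s : ℝ, 0 < s ∧ s < 1 ∧ ∀ᶠ k in atTop, ∃ ℓ₀ : ℕ, 1 ≤ ℓ₀ ∧ ℓ₀ ≤ reg.L k ∧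
      (ℓ₀ : ℝ) * reg.a k ≤ K₀ * (1 + |Real.log (reg.a k)|) ∧ ∀ S : ℕ, reg.L k ≤ S →
        ∀ (f : Fin Nf) (v : Site 4), v ∈ box 4 S → ‖v‖ = (ℓ₀ : ℝ) →
          (ℓ₀ : ℝ) ^ q * (1 + |reg.β k|) ^ q * fm Nf (reg.β k) (bare reg (fun f => M₀ + m f) k) S f v s ≤ 1) := by
  simp only [bare_mcrit_shift reg M₀ m _ reg' hreg']
  subst hreg'
  rfl

/-- **The per-mass package `(i) ∧ one-scale ∧ (iii) ∧ (iv)` of the shifted regularisation at `m` is the package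
of `reg` at `M₀ + m`.** -/
theorem package_mcrit_shift_iff (reg : QCDRegularisation Nf) (M₀ : ℝ) (m : Fin Nf → ℝ)
    (reg' : QCDRegularisation Nf)
    (hreg' : reg' = { reg with mcrit := fun k => reg.mcrit k + reg.a k * M₀ / reg.Zm k }) :
    (ClauseI reg' m ∧
      (∀ q : ℕ, ∃ K₀ s : ℝ, 0 < s ∧ s < 1 ∧ ∀ᶠ k in atTop, ∃ ℓ₀ : ℕ, 1 ≤ ℓ₀ ∧ ℓ₀ ≤ reg'.L k ∧
        (ℓ₀ : ℝ) * reg'.a k ≤ K₀ * (1 + |Real.log (reg'.a k)|) ∧ ∀ S : ℕ, reg'.L k ≤ S →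
          ∀ (f : Fin Nf) (v : Site 4), v ∈ box 4 S → ‖v‖ = (ℓ₀ : ℝ) →
            (ℓ₀ : ℝ) ^ q * (1 + |reg'.β k|) ^ q * fm Nf (reg'.β k) (bare reg' m k) S f v s ≤ 1) ∧
      Lower reg' m ∧ Sign reg' m) ↔
    (ClauseI reg (fun f => M₀ + m f) ∧
      (∀ q : ℕ, ∃ K₀ s : ℝ, 0 < s ∧ s < 1 ∧ ∀ᶠ k in atTop, ∃ ℓ₀ : ℕ, 1 ≤ ℓ₀ ∧ ℓ₀ ≤ reg.L k ∧
        (ℓ₀ : ℝ) * reg.a k ≤ K₀ * (1 + |Real.log (reg.a k)|) ∧ ∀ S : ℕ, reg.L k ≤ S →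
          ∀ (f : Fin Nf) (v : Site 4), v ∈ box 4 S → ‖v‖ = (ℓ₀ : ℝ) →
            (ℓ₀ : ℝ) ^ q * (1 + |reg.β k|) ^ q * fm Nf (reg.β k) (bare reg (fun f => M₀ + m f) k) S f v s ≤ 1) ∧
      Lower reg (fun f => M₀ + m f) ∧ Sign reg (fun f => M₀ + m f)) := by
  rw [oneScale_mcrit_shift_iff reg M₀ m reg' hreg']
  have hb : ∀ k, bare reg' m k = bare reg (fun f => M₀ + m f) k := fun k => bare_mcrit_shift reg M₀ m k reg' hreg'
  have hI : ClauseI reg' m ↔ ClauseI reg (fun f => M₀ + m f) := by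
    have h : ∀ (k : ℕ) (fl : Fin Nf), reg.mcrit k + reg.a k * M₀ / reg.Zm k + reg.a k * m fl / reg.Zm k =
        reg.mcrit k + reg.a k * (M₀ + m fl) / reg.Zm k := by intros; ring
    subst hreg'
    simp only [ClauseI, h]
  have hL : Lower reg' m ↔ Lower reg (fun f => M₀ + m f) := by
    simp only [Lower, hb]; subst hreg'; rfl
  have hS : Sign reg' m ↔ Sign reg (fun f => M₀ + m f) := by
    simp only [Sign, hb]; subst hreg'; rfl
  rw [hI, hL, hS]

/-- **Everything in the body EXCEPT the pin passes to every up-shift `M₀ ≥ 0`.** -/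
theorem bodyMinusPin_mcrit_shift (reg : QCDRegularisation Nf) {M₀ : ℝ} (hM₀ : 0 ≤ M₀)
    (reg' : QCDRegularisation Nf)
    (hreg' : reg' = { reg with mcrit := fun k => reg.mcrit k + reg.a k * M₀ / reg.Zm k })
    (h : reg.HasMassScaling ∧ (reg.scheme 0 0 0).HasAsymptoticScaling ∧
      ∀ m : Fin Nf → ℝ, (∀ f, 0 < m f) → ClauseI reg m ∧
        (∀ q : ℕ, ∃ K₀ s : ℝ, 0 < s ∧ s < 1 ∧ ∀ᶠ k in atTop, ∃ ℓ₀ : ℕ, 1 ≤ ℓ₀ ∧ ℓ₀ ≤ reg.L k ∧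
          (ℓ₀ : ℝ) * reg.a k ≤ K₀ * (1 + |Real.log (reg.a k)|) ∧ ∀ S : ℕ, reg.L k ≤ S →
            ∀ (f : Fin Nf) (v : Site 4), v ∈ box 4 S → ‖v‖ = (ℓ₀ : ℝ) →
              (ℓ₀ : ℝ) ^ q * (1 + |reg.β k|) ^ q * fm Nf (reg.β k) (bare reg m k) S f v s ≤ 1) ∧
        Lower reg m ∧ Sign reg m) :
    reg'.HasMassScaling ∧ (reg'.scheme 0 0 0).HasAsymptoticScaling ∧
      ∀ m : Fin Nf → ℝ, (∀ f, 0 < m f) → ClauseI reg' m ∧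
        (∀ q : ℕ, ∃ K₀ s : ℝ, 0 < s ∧ s < 1 ∧ ∀ᶠ k in atTop, ∃ ℓ₀ : ℕ, 1 ≤ ℓ₀ ∧ ℓ₀ ≤ reg'.L k ∧
          (ℓ₀ : ℝ) * reg'.a k ≤ K₀ * (1 + |Real.log (reg'.a k)|) ∧ ∀ S : ℕ, reg'.L k ≤ S →
            ∀ (f : Fin Nf) (v : Site 4), v ∈ box 4 S → ‖v‖ = (ℓ₀ : ℝ) →
              (ℓ₀ : ℝ) ^ q * (1 + |reg'.β k|) ^ q * fm Nf (reg'.β k) (bare reg' m k) S f v s ≤ 1) ∧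
        Lower reg' m ∧ Sign reg' m := by
  obtain ⟨hMS, hAS, hP⟩ := h
  refine ⟨?_, ?_, fun m hm => ?_⟩
  · subst hreg'; exact hMS
  · subst hreg'; exact hAS
  · rw [package_mcrit_shift_iff reg M₀ m reg' hreg']
    exact hP _ fun f => by linarith [hm f]

/-- **The up-shift of a witness of the crux body is a witness iff the ORIGINAL regularisation is chiral above the
shift** — the family of witnesses generated from one witness by up-shifts is truncated exactly by chirality; the
pin is the unique datum of the body that locates the chiral point. -/
theorem body_mcrit_shift_iff_chiralAbove (reg : QCDRegularisation Nf) {M₀ : ℝ} (hM₀ : 0 ≤ M₀)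
    (reg' : QCDRegularisation Nf)
    (hreg' : reg' = { reg with mcrit := fun k => reg.mcrit k + reg.a k * M₀ / reg.Zm k })
    (h : reg.HasMassScaling ∧ reg.IsChiralAtZero ∧ (reg.scheme 0 0 0).HasAsymptoticScaling ∧
      ∀ m : Fin Nf → ℝ, (∀ f, 0 < m f) → ClauseI reg m ∧
        (∀ q : ℕ, ∃ K₀ s : ℝ, 0 < s ∧ s < 1 ∧ ∀ᶠ k in atTop, ∃ ℓ₀ : ℕ, 1 ≤ ℓ₀ ∧ ℓ₀ ≤ reg.L k ∧
          (ℓ₀ : ℝ) * reg.a k ≤ K₀ * (1 + |Real.log (reg.a k)|) ∧ ∀ S : ℕ, reg.L k ≤ S →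
            ∀ (f : Fin Nf) (v : Site 4), v ∈ box 4 S → ‖v‖ = (ℓ₀ : ℝ) →
              (ℓ₀ : ℝ) ^ q * (1 + |reg.β k|) ^ q * fm Nf (reg.β k) (bare reg m k) S f v s ≤ 1) ∧
        Lower reg m ∧ Sign reg m) :
    (reg'.HasMassScaling ∧ reg'.IsChiralAtZero ∧ (reg'.scheme 0 0 0).HasAsymptoticScaling ∧
      ∀ m : Fin Nf → ℝ, (∀ f, 0 < m f) → ClauseI reg' m ∧
        (∀ q : ℕ, ∃ K₀ s : ℝ, 0 < s ∧ s < 1 ∧ ∀ᶠ k in atTop, ∃ ℓ₀ : ℕ, 1 ≤ ℓ₀ ∧ ℓ₀ ≤ reg'.L k ∧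
          (ℓ₀ : ℝ) * reg'.a k ≤ K₀ * (1 + |Real.log (reg'.a k)|) ∧ ∀ S : ℕ, reg'.L k ≤ S →
            ∀ (f : Fin Nf) (v : Site 4), v ∈ box 4 S → ‖v‖ = (ℓ₀ : ℝ) →
              (ℓ₀ : ℝ) ^ q * (1 + |reg'.β k|) ^ q * fm Nf (reg'.β k) (bare reg' m k) S f v s ≤ 1) ∧
        Lower reg' m ∧ Sign reg' m) ↔
    ∀ ε > (0 : ℝ), ∃ m : Fin Nf → ℝ, (∀ f, M₀ < m f) ∧ ¬ (reg.scheme m 0 0).HasLatticeMassGap ε := by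
  obtain ⟨hMS, -, hAS, hP⟩ := h
  obtain ⟨hMS', hAS', hP'⟩ := bodyMinusPin_mcrit_shift reg hM₀ reg' hreg' ⟨hMS, hAS, hP⟩
  have hch : reg'.IsChiralAtZero ↔
      ∀ ε > (0 : ℝ), ∃ m : Fin Nf → ℝ, (∀ f, M₀ < m f) ∧ ¬ (reg.scheme m 0 0).HasLatticeMassGap ε := by
    subst hreg'
    rw [Summit.QuantumFields.QCD.Theorems.RobustYangMillsHandover.Negative.isChiralAtZero_mcrit_shift_iff]
    refine forall₂_congr fun ε _ => ⟨fun ⟨m, hm, h⟩ => ⟨fun f => M₀ + m f, fun f => by linarith [hm f], h⟩,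
      fun ⟨m, hm, h⟩ => ⟨fun f => m f - M₀, fun f => by linarith [hm f], ?_⟩⟩
    have : (fun f => M₀ + (m f - M₀)) = m := funext fun f => by ring
    rwa [this]
  rw [← hch]
  exact ⟨fun h' => h'.2.1, fun h' => ⟨hMS', h', hAS', hP'⟩⟩

/-- **Certified warning ("package ⇒ chiral" cannot be a `∀ reg` item).** The statement "every regularisation with
both scalings and the package at every positive tuple is chiral at zero" is EQUIVALENT to "every such
regularisation is chiral above EVERY offset `M₀ ≥ 0`" (gapless or sign-singular tuples at arbitrarily heavy masses). -/
theorem packageForcesChirality_iff :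
    (∀ reg : QCDRegularisation Nf, (reg.HasMassScaling ∧ (reg.scheme 0 0 0).HasAsymptoticScaling ∧
      ∀ m : Fin Nf → ℝ, (∀ f, 0 < m f) → ClauseI reg m ∧
        (∀ q : ℕ, ∃ K₀ s : ℝ, 0 < s ∧ s < 1 ∧ ∀ᶠ k in atTop, ∃ ℓ₀ : ℕ, 1 ≤ ℓ₀ ∧ ℓ₀ ≤ reg.L k ∧
          (ℓ₀ : ℝ) * reg.a k ≤ K₀ * (1 + |Real.log (reg.a k)|) ∧ ∀ S : ℕ, reg.L k ≤ S →
            ∀ (f : Fin Nf) (v : Site 4), v ∈ box 4 S → ‖v‖ = (ℓ₀ : ℝ) →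
              (ℓ₀ : ℝ) ^ q * (1 + |reg.β k|) ^ q * fm Nf (reg.β k) (bare reg m k) S f v s ≤ 1) ∧
        Lower reg m ∧ Sign reg m) → reg.IsChiralAtZero) ↔
    (∀ reg : QCDRegularisation Nf, (reg.HasMassScaling ∧ (reg.scheme 0 0 0).HasAsymptoticScaling ∧
      ∀ m : Fin Nf → ℝ, (∀ f, 0 < m f) → ClauseI reg m ∧
        (∀ q : ℕ, ∃ K₀ s : ℝ, 0 < s ∧ s < 1 ∧ ∀ᶠ k in atTop, ∃ ℓ₀ : ℕ, 1 ≤ ℓ₀ ∧ ℓ₀ ≤ reg.L k ∧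
          (ℓ₀ : ℝ) * reg.a k ≤ K₀ * (1 + |Real.log (reg.a k)|) ∧ ∀ S : ℕ, reg.L k ≤ S →
            ∀ (f : Fin Nf) (v : Site 4), v ∈ box 4 S → ‖v‖ = (ℓ₀ : ℝ) →
              (ℓ₀ : ℝ) ^ q * (1 + |reg.β k|) ^ q * fm Nf (reg.β k) (bare reg m k) S f v s ≤ 1) ∧
        Lower reg m ∧ Sign reg m) →
      ∀ M₀ : ℝ, 0 ≤ M₀ → ∀ ε > (0 : ℝ), ∃ m : Fin Nf → ℝ, (∀ f, M₀ < m f) ∧ ¬ (reg.scheme m 0 0).HasLatticeMassGap ε) := by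
  constructor
  · intro h reg hB M₀ hM₀
    have hB' := bodyMinusPin_mcrit_shift reg hM₀ _ rfl hB
    have hch := h _ hB'
    rw [Summit.QuantumFields.QCD.Theorems.RobustYangMillsHandover.Negative.isChiralAtZero_mcrit_shift_iff] at hch
    intro ε hε
    obtain ⟨m, hm, hg⟩ := hch ε hε
    exact ⟨fun f => M₀ + m f, fun f => by linarith [hm f], hg⟩
  · intro h reg hB ε hε
    obtain ⟨m, hm, hg⟩ := h reg hB 0 le_rfl ε hε
    exact ⟨m, hm, hg⟩

/-- … hence "package ⇒ chiral" is refuted by any single package-carrying regularisation that is uniformly gapped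
above some threshold `M₀ ≥ 0` (the expected shape of every honest `OneScaleTrajectory` witness: pions are massive
above the chiral point) — so the pin must ride inside the `∃ reg`, as filed, and a split of the crux of the form
"package ⇒ chiral" must quantify over package-MINIMAL regularisations only. -/
theorem not_packageForcesChirality_of (reg : QCDRegularisation Nf)
    (hB : reg.HasMassScaling ∧ (reg.scheme 0 0 0).HasAsymptoticScaling ∧
      ∀ m : Fin Nf → ℝ, (∀ f, 0 < m f) → ClauseI reg m ∧
        (∀ q : ℕ, ∃ K₀ s : ℝ, 0 < s ∧ s < 1 ∧ ∀ᶠ k in atTop, ∃ ℓ₀ : ℕ, 1 ≤ ℓ₀ ∧ ℓ₀ ≤ reg.L k ∧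
          (ℓ₀ : ℝ) * reg.a k ≤ K₀ * (1 + |Real.log (reg.a k)|) ∧ ∀ S : ℕ, reg.L k ≤ S →
            ∀ (f : Fin Nf) (v : Site 4), v ∈ box 4 S → ‖v‖ = (ℓ₀ : ℝ) →
              (ℓ₀ : ℝ) ^ q * (1 + |reg.β k|) ^ q * fm Nf (reg.β k) (bare reg m k) S f v s ≤ 1) ∧
        Lower reg m ∧ Sign reg m)
    {M₀ : ℝ} (hM₀ : 0 ≤ M₀)
    (hgap : ∃ ε > (0 : ℝ), ∀ m : Fin Nf → ℝ, (∀ f, M₀ < m f) → (reg.scheme m 0 0).HasLatticeMassGap ε) :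
    ¬ (∀ reg : QCDRegularisation Nf, (reg.HasMassScaling ∧ (reg.scheme 0 0 0).HasAsymptoticScaling ∧
      ∀ m : Fin Nf → ℝ, (∀ f, 0 < m f) → ClauseI reg m ∧
        (∀ q : ℕ, ∃ K₀ s : ℝ, 0 < s ∧ s < 1 ∧ ∀ᶠ k in atTop, ∃ ℓ₀ : ℕ, 1 ≤ ℓ₀ ∧ ℓ₀ ≤ reg.L k ∧
          (ℓ₀ : ℝ) * reg.a k ≤ K₀ * (1 + |Real.log (reg.a k)|) ∧ ∀ S : ℕ, reg.L k ≤ S →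
            ∀ (f : Fin Nf) (v : Site 4), v ∈ box 4 S → ‖v‖ = (ℓ₀ : ℝ) →
              (ℓ₀ : ℝ) ^ q * (1 + |reg.β k|) ^ q * fm Nf (reg.β k) (bare reg m k) S f v s ≤ 1) ∧
        Lower reg m ∧ Sign reg m) → reg.IsChiralAtZero) := by
  intro h
  obtain ⟨ε, hε, hg⟩ := hgap
  obtain ⟨m, hm, hn⟩ := (packageForcesChirality_iff.1 h) reg hB M₀ hM₀ ε hε
  exact hn (hg m hm)

/-- **Package-minimality unfolded on `reg` itself.** "Every down-shift `m_crit ↦ m_crit − a_k M₀/Z_m`, `M₀ > 0`,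
loses the package at some positive tuple" is the statement that for every `M₀ > 0` the package of `reg` fails at
some tuple with all components `> −M₀` (minimality is a property of `reg` alone, no new object). -/
theorem packageMinimal_iff (reg : QCDRegularisation Nf) :
    (∀ M₀ > (0 : ℝ), ∀ reg' : QCDRegularisation Nf,
      reg' = { reg with mcrit := fun k => reg.mcrit k + reg.a k * (-M₀) / reg.Zm k } →
        ∃ m : Fin Nf → ℝ, (∀ f, 0 < m f) ∧ ¬ (ClauseI reg' m ∧
          (∀ q : ℕ, ∃ K₀ s : ℝ, 0 < s ∧ s < 1 ∧ ∀ᶠ k in atTop, ∃ ℓ₀ : ℕ, 1 ≤ ℓ₀ ∧ ℓ₀ ≤ reg'.L k ∧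
            (ℓ₀ : ℝ) * reg'.a k ≤ K₀ * (1 + |Real.log (reg'.a k)|) ∧ ∀ S : ℕ, reg'.L k ≤ S →
              ∀ (f : Fin Nf) (v : Site 4), v ∈ box 4 S → ‖v‖ = (ℓ₀ : ℝ) →
                (ℓ₀ : ℝ) ^ q * (1 + |reg'.β k|) ^ q * fm Nf (reg'.β k) (bare reg' m k) S f v s ≤ 1) ∧
          Lower reg' m ∧ Sign reg' m)) ↔
    ∀ M₀ > (0 : ℝ), ∃ m : Fin Nf → ℝ, (∀ f, -M₀ < m f) ∧ ¬ (ClauseI reg m ∧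
      (∀ q : ℕ, ∃ K₀ s : ℝ, 0 < s ∧ s < 1 ∧ ∀ᶠ k in atTop, ∃ ℓ₀ : ℕ, 1 ≤ ℓ₀ ∧ ℓ₀ ≤ reg.L k ∧
        (ℓ₀ : ℝ) * reg.a k ≤ K₀ * (1 + |Real.log (reg.a k)|) ∧ ∀ S : ℕ, reg.L k ≤ S →
          ∀ (f : Fin Nf) (v : Site 4), v ∈ box 4 S → ‖v‖ = (ℓ₀ : ℝ) →
            (ℓ₀ : ℝ) ^ q * (1 + |reg.β k|) ^ q * fm Nf (reg.β k) (bare reg m k) S f v s ≤ 1) ∧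
      Lower reg m ∧ Sign reg m) := by
  refine forall₂_congr fun M₀ _ => ?_
  constructor
  · intro h
    obtain ⟨m, hm, hn⟩ := h _ rfl
    refine ⟨fun f => m f - M₀, fun f => by linarith [hm f], fun hp => hn ?_⟩
    rw [package_mcrit_shift_iff reg (-M₀) m _ rfl]
    have : (fun f => -M₀ + m f) = fun f => m f - M₀ := funext fun f => by ring
    rwa [this]
  · rintro ⟨m, hm, hn⟩ reg' hreg'
    refine ⟨fun f => m f + M₀, fun f => by linarith [hm f], fun hp => hn ?_⟩
    rw [package_mcrit_shift_iff reg (-M₀) _ reg' hreg'] at hp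
    have : (fun f => -M₀ + (m f + M₀)) = m := funext fun f => by ring
    rwa [this] at hp

/-- **A regularisation whose package holds at EVERY real tuple is not package-minimal** (and neither is any
down-shift of it: its orbit has no minimal element).  Clause (iii) does NOT exclude this — it pins only
`|m_f(k) + 4| < 41/10`, true eventually for every FIXED real tuple since `a_k m_f / Z_m(k) → 0`. -/
theorem not_packageMinimal_of_forall (reg : QCDRegularisation Nf)
    (h : ∀ m : Fin Nf → ℝ, ClauseI reg m ∧
      (∀ q : ℕ, ∃ K₀ s : ℝ, 0 < s ∧ s < 1 ∧ ∀ᶠ k in atTop, ∃ ℓ₀ : ℕ, 1 ≤ ℓ₀ ∧ ℓ₀ ≤ reg.L k ∧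
        (ℓ₀ : ℝ) * reg.a k ≤ K₀ * (1 + |Real.log (reg.a k)|) ∧ ∀ S : ℕ, reg.L k ≤ S →
          ∀ (f : Fin Nf) (v : Site 4), v ∈ box 4 S → ‖v‖ = (ℓ₀ : ℝ) →
            (ℓ₀ : ℝ) ^ q * (1 + |reg.β k|) ^ q * fm Nf (reg.β k) (bare reg m k) S f v s ≤ 1) ∧
      Lower reg m ∧ Sign reg m) :
    ¬ ∀ M₀ > (0 : ℝ), ∃ m : Fin Nf → ℝ, (∀ f, -M₀ < m f) ∧ ¬ (ClauseI reg m ∧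
      (∀ q : ℕ, ∃ K₀ s : ℝ, 0 < s ∧ s < 1 ∧ ∀ᶠ k in atTop, ∃ ℓ₀ : ℕ, 1 ≤ ℓ₀ ∧ ℓ₀ ≤ reg.L k ∧
        (ℓ₀ : ℝ) * reg.a k ≤ K₀ * (1 + |Real.log (reg.a k)|) ∧ ∀ S : ℕ, reg.L k ≤ S →
          ∀ (f : Fin Nf) (v : Site 4), v ∈ box 4 S → ‖v‖ = (ℓ₀ : ℝ) →
            (ℓ₀ : ℝ) ^ q * (1 + |reg.β k|) ^ q * fm Nf (reg.β k) (bare reg m k) S f v s ≤ 1) ∧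
      Lower reg m ∧ Sign reg m) := by
  intro hmin
  obtain ⟨m, -, hm⟩ := hmin 1 one_pos
  exact hm (h m)

end Summit.QuantumFields.QCD.Theorems.ChiralOneScaleTrajectory.Negative

end
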